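import Summits.ABC.ABC.Theses.DefiniteXi
import Summits.ABC.ABC.Theorems.DefiniteXiFreyModularity
import Summits.ABC.ABC.Theorems.DefiniteXiDefiniteRTControlPrimeSmulTransportDeg
import Summits.ABC.ABC.Theorems.DefiniteXiDefiniteRTControlPrimeValTransport
import Summits.ABC.ABC.Theorems.DefiniteXiDefiniteRTControlPrimeFreyScale
import Summits.ABC.ABC.Theorems.DefiniteXiDefiniteRTControlPrimeFreyLocal
import Literature.NumberTheory.EllipticCurves.TakahashiDegreeFormulaCoprimeProofs
import Literature.NumberTheory.EllipticCurves.PastenSpectralDegree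
import Literature.NumberTheory.EllipticCurves.PastenHeightBounds
import Literature.NumberTheory.EllipticCurves.ModularCurveManinSemistableBridgeProofs
import Literature.NumberTheory.EllipticCurves.ModularDegreeMinimal
import Literature.NumberTheory.EllipticCurves.IsogenyVariableChangeProofs
import Literature.NumberTheory.EllipticCurves.IsogenyCompProofs
import Literature.NumberTheory.EllipticCurves.IsogenyDualProofs
import HarnessLib

/-!
# Crux `DefiniteXi.DefiniteRTControlPrime` (stmt-ABC-11338) — line `Sketch` (card
`optimal-pivot-spine`), LEAD SKELETON

`DefiniteRTControlPrime`: for every `ε > 0` there is `C` such that for all coprime `a, b` with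
`ab(a+b) ≠ 0`, `N` the conductor of the Frey curve `E = freyCurve a b`, every odd prime `q ∣ N`
and every datum `D` of minimal degree among the modular parametrisation data of the MODEL
`freyCurve a b` at level `N`:
`deg D ≤ C · N^ε · brandtXi (N/q) q (a(E)) · v_q(Δ_min(E))`.

## Composition (`DefiniteRTControlPrime_of`, proved below modulo the stubs; `C = 4·163²`, the
`N^ε` is idle)

Write `N = M q`; Frey curves are multiplicative at every odd bad prime, so `gcd(M, q) = 1`
(`stub_freyLocal`).  Let `W_m = C • E` be a global minimal model (`hasGlobalMinimalModel_rat_holds`),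
`D₁` a datum of `W_m` of minimal degree (data of `E` transport to `W_m`), `f₁ := D₁.f`,
`(W₀, D₀)` the lattice-optimal datum of the class (`exists_optimalDatum'`, minimal among ALL data
with newform `f₁` by `modularDegree_le_of_isogenyMap_ker_eq_bot`), and `(W⋆, P⋆)` a datum of
minimal degree among the data, at level `N`, of the conductor-`N` curves with newform `f₁`
(`exists_conductorMinimal`, a well-founded minimum; nonempty because of `(W_m, D₁)`).  Then
* `deg D ≤ deg D₁' = (num u_C)² · deg D₁ ≤ 4 · deg D₁` — `D₁'` the transport of `D₁` back to the
  Frey model WITH its degree (`stub_smulTransportDeg`), `|num u_C| ≤ 2` (`stub_freyScale`), and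
  minimality of `D`;
* `deg D₁ ≤ 163 · deg D₀` — `stub_pasten163` (named fact `PastenShimura2024_minimalDegree_le_163_mul`);
* `deg D₀ ≤ deg P⋆` — class-minimality of `D₀`;
* `deg P⋆ ≤ ξ(M, q)(a(W⋆)) · v_q(Δ_min(W⋆))` — `stub_takahashi` (named fact
  `takahashi2001_thm_2_3_of_coprime`) through the tree corollary
  `takahashi2001_thm_2_3_of_coprime.modularDegree_le_brandtXi_mul`, and `a(W⋆) = a(f₁) = a(W_m) = a(E)`;
* `v_q(Δ_min(W⋆)) ≤ 163 · v_q(Δ_min(E))` — `stub_valTransport` from `stub_pastenLemma68` (named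
  fact `PastenShimura2024_lemma_6_8`) along the `ℚ`-isogeny `E ~ W_m ~ W⋆` (`isIsogenous_smul`,
  `isIsogenous_of_f_eq` proved here from `isIsogenous_of_forall_mul_mem_lattice`).

The three named facts are the formal debt of this crux (Néron models of `J₀(N)` and Grothendieck's
pairing; Mazur–Kenku; Néron functoriality of component groups); the line closes the crux
CONDITIONALLY on exactly them.  Every other stub is provable bookkeeping.
-/

set_option linter.dupNamespace false

noncomputable section

namespace Summit.ABC.ABC.Cruxes.DefiniteRTControlPrime.Sketch

open Summit.ABC.ABC.Theses.DefiniteXi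
open Literature.NumberTheory.EllipticCurves Literature.NumberTheory.EllipticCurves.ModularForms
open Literature.NumberTheory.Automorphic
open WeierstrassCurve

/-! ## Stubs: the three named facts (formal debt, leaves — NOT delegated) -/

/-- STUB (named fact, leaf): Takahashi 2001 Thm. 2.3 at `r ∥ N` (`δ · i = h_r · j`, `i j = ord_r Δ_min`,
`i ∣ h_r`) for the optimal curve among the conductor-`N` curves. -/
theorem stub_takahashi : takahashi2001_thm_2_3_of_coprime := by
  sorry

/-- STUB (named fact, leaf): Pasten 2024 §3 p. 13 (Mazur–Kenku): the minimal parametrisation degree of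
a globally minimal curve of the class is `≤ 163 · δ_{1,N}`. -/
theorem stub_pasten163 : PastenShimura2024_minimalDegree_le_163_mul := by
  sorry

/-- STUB (named fact, leaf): Pasten 2024 Lemma 6.8: `c_p(A)/c_p(B)` has height `≤ 163` in a
`ℚ`-isogeny class at a multiplicative prime. -/
theorem stub_pastenLemma68 : PastenShimura2024_lemma_6_8 := by
  sorry

/-! ## Stubs: provable bookkeeping (delegated; ALL FOUR CLOSED in wave 1) -/

/-- STUB (S4, Frey local arithmetic) — CLOSED (p96900, `Theorems/DefiniteXiDefiniteRTControlPrimeFreyLocal.lean`): an odd prime of bad reduction of a Frey curve divides the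
conductor exactly once — `E_(a,b)` is multiplicative at every odd `q ∣ N`
(`hasMultiplicativeReductionAt_freyCurve_of_ne_two`, `dvd_of_dvd_conductorNorm_freyCurve`), so the
conductor exponent is `1` (`conductorExponent_eq_one_iff_holds`, `factorization_conductorNorm_holds`). -/
theorem stub_freyLocal (a b : ℤ) (hab : IsCoprime a b) (h0 : a * b * (a + b) ≠ 0) (q : ℕ)
    (hq : q.Prime) (hq2 : q ≠ 2) (hqN : q ∣ (freyCurve a b).conductorNorm ℤ) :
    ((freyCurve a b).conductorNorm ℤ / q).Coprime q :=
  Summit.ABC.ABC.Theorems.DefiniteRTControlPrime.stub_freyLocal a b hab h0 q hq hq2 hqN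

/-- STUB (S5, valuation transport) — CLOSED (p96813, `Theorems/DefiniteXiDefiniteRTControlPrimeValTransport.lean`): along a `ℚ`-isogeny from a Frey curve, the exponent of an odd
bad prime `q` in the minimal discriminant grows at most by the factor `163`
(`PastenShimura2024_lemma_6_8` at the place over `q`, where `E_(a,b)` is multiplicative;
`factorization_minimalDiscriminantNorm_holds` converts `ordMinimalDiscriminant` to the exponent). -/
theorem stub_valTransport : PastenShimura2024_lemma_6_8 →
    ∀ (a b : ℤ), IsCoprime a b → a * b * (a + b) ≠ 0 → ∀ q : ℕ, q.Prime → q ≠ 2 →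
      q ∣ (freyCurve a b).conductorNorm ℤ →
      ∀ (W' : WeierstrassCurve ℚ) [W'.IsElliptic], (freyCurve a b).IsIsogenous W' →
        (W'.minimalDiscriminantNorm ℤ).factorization q ≤
          163 * ((freyCurve a b).minimalDiscriminantNorm ℤ).factorization q :=
  Summit.ABC.ABC.Theorems.DefiniteRTControlPrime.stub_valTransport

/-- STUB (S6, model transport with degree) — CLOSED (p96728, `Theorems/DefiniteXiDefiniteRTControlPrimeSmulTransportDeg.lean`): a datum of `C • W` at level `N` yields a datum of `W`
with the same newform and degree `(num u)² · deg` (`u = C.u`; the tree's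
`nonempty_modularParametrizationData_of_smul` is this construction with the degree forgotten). -/
theorem stub_smulTransportDeg {W : WeierstrassCurve ℚ} [W.IsElliptic] (C : VariableChange ℚ)
    {N : ℕ} [NeZero N] (D : ModularParametrizationData (C • W) N) :
    ∃ D' : ModularParametrizationData W N,
      D'.f = D.f ∧ D'.deg = (C.u : ℚ).num.natAbs ^ 2 * D.deg :=
  Summit.ABC.ABC.Theorems.DefiniteRTControlPrime.stub_smulTransportDeg C D

/-- STUB (S7, Frey scale) — CLOSED (p96829, `Theorems/DefiniteXiDefiniteRTControlPrimeFreyScale.lean`): a change of variables taking the Frey model to a globally minimal model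
has `|num u| ≤ 2` (`c₄ = u⁻⁴ · 16(a² + ab + b²)` and `Δ = u⁻¹² · 16 (ab(a+b))²` are integral and
`gcd(a² + ab + b², ab(a+b)) = 1`, so `(num u)⁴ ∣ 16`). -/
theorem stub_freyScale (a b : ℤ) (hab : IsCoprime a b) (h0 : a * b * (a + b) ≠ 0)
    (C : VariableChange ℚ) (hC : (C • freyCurve a b).IsGloballyMinimal) :
    (C.u : ℚ).num.natAbs ≤ 2 :=
  Summit.ABC.ABC.Theorems.DefiniteRTControlPrime.stub_freyScale a b hab h0 C hC

/-! ## Proved helpers of the composition -/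

/-- **Two elliptic curves over `ℚ` carrying parametrisation data with the same newform are
`ℚ`-isogenous**: both are isogenous to the lattice-optimal curve `W₀` of the class
(`exists_optimalDatum'`: `Λ_{W₀} = c₀ Λ_f`) along the analytic maps `z ↦ (c/c₀) z`
(`isIsogenous_of_forall_mul_mem_lattice`). [folklore] -/
theorem isIsogenous_of_f_eq {W W' : WeierstrassCurve ℚ} [W.IsElliptic] [W'.IsElliptic] {N : ℕ}
    [NeZero N] (D : ModularParametrizationData W N) (D' : ModularParametrizationData W' N)
    (hf : D'.f = D.f) : W.IsIsogenous W' := by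
  obtain ⟨W₀, hW₀, D₀, hf₀, h₀⟩ := D.exists_optimalDatum'
  haveI := hW₀
  have key : ∀ {V : WeierstrassCurve ℚ} [V.IsElliptic] (P : ModularParametrizationData V N),
      P.f = D₀.f → W₀.IsIsogenous V := by
    intro V _ P hP
    have hc₀ : (D₀.c : ℚ) ≠ 0 := by exact_mod_cast D₀.maninConstant_ne_zero_holds
    have hc : (P.c : ℚ) ≠ 0 := by exact_mod_cast P.maninConstant_ne_zero_holds
    refine isIsogenous_of_forall_mul_mem_lattice D₀.isNeronLattice.1 D₀.isNeronLattice.2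
      P.isNeronLattice.1 P.isNeronLattice.2 (c := (P.c : ℚ) / D₀.c) (div_ne_zero hc hc₀) ?_
    intro z hz
    obtain ⟨w, hw, rfl⟩ := h₀ z hz
    have hw' : w ∈ periodLattice P.f := by rw [hP]; exact hw
    have : (((P.c : ℚ) / D₀.c : ℚ) : ℂ) * ((D₀.c : ℂ) * w) = (P.c : ℂ) * w := by
      have hc₀' : (D₀.c : ℂ) ≠ 0 := D₀.cast_c_ne_zero
      push_cast
      field_simp
    rw [this]
    exact P.smul_periodLattice_le w hw'
  have h1 : W₀.IsIsogenous W := key D hf₀.symm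
  have h2 : W₀.IsIsogenous W' := key D' (hf.trans hf₀.symm)
  exact h1.symm_of_charZero.trans' h2

/-- **The conductor-restricted optimal pivot.** Given a datum `D₁` of a conductor-`N` curve `V`,
there is a datum `P⋆` of some elliptic `W⋆/ℚ` of conductor `N`, with the same newform, of minimal
degree among all data at level `N` of all conductor-`N` curves with that newform (a minimum over a
nonempty set of naturals) — verbatim the minimality clause of `takahashi2001_thm_2_3_of_coprime`.
[folklore] -/
theorem exists_conductorMinimal {V : WeierstrassCurve ℚ} [V.IsElliptic] {N : ℕ} [NeZero N]
    (D₁ : ModularParametrizationData V N) (hV : V.conductorNorm ℤ = N) :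
    ∃ (Ws : WeierstrassCurve ℚ) (_ : Ws.IsElliptic) (Ps : ModularParametrizationData Ws N),
      Ws.conductorNorm ℤ = N ∧ Ps.f = D₁.f ∧
      ∀ (W' : WeierstrassCurve ℚ) [W'.IsElliptic], W'.conductorNorm ℤ = N →
        ∀ P' : ModularParametrizationData W' N, P'.f = Ps.f →
          Ps.modularDegree ≤ P'.modularDegree := by
  classical
  set S : Set ℕ := {d | ∃ (W' : WeierstrassCurve ℚ) (_ : W'.IsElliptic)
      (P' : ModularParametrizationData W' N),
      W'.conductorNorm ℤ = N ∧ P'.f = D₁.f ∧ P'.modularDegree = d} with hS_def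
  have hS : S.Nonempty := ⟨D₁.modularDegree, V, ‹_›, D₁, hV, rfl, rfl⟩
  obtain ⟨Ws, hWs, Ps, hNs, hfs, hdeg⟩ := Nat.sInf_mem hS
  refine ⟨Ws, hWs, Ps, hNs, hfs, fun W' _ hW' P' hP' => ?_⟩
  rw [hdeg]
  exact Nat.sInf_le ⟨W', ‹_›, P', hW', hP'.trans hfs, rfl⟩

/-! ## The composition -/

/-- **The crux from the stubs** (`C = 4 · 163²`, `N^ε` idle): see the module docstring for the
chain `deg D ≤ 4 deg D₁ ≤ 4·163 deg D₀ ≤ 4·163 deg P⋆ ≤ 4·163 ξ v_q(Δ_min W⋆) ≤ 4·163² ξ v_q(Δ_min E)`. -/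
theorem DefiniteRTControlPrime_of : DefiniteRTControlPrime := by
  intro ε hε
  refine ⟨4 * 163 * 163, ?_⟩
  intro a b hab h0 N _ hN q hq hq2 hqN D hDmin
  -- `N = M q`
  obtain ⟨M, hM⟩ := hqN
  rw [mul_comm] at hM
  subst hM
  haveI := isElliptic_freyCurve h0
  have hdiv : M * q / q = M := Nat.mul_div_cancel M hq.pos
  rw [hdiv]
  have hqN' : q ∣ (freyCurve a b).conductorNorm ℤ := by rw [hN]; exact Dvd.intro_left M rfl
  -- `gcd(M, q) = 1`
  have hcop : M.Coprime q := by
    have h := stub_freyLocal a b hab h0 q hq hq2 hqN'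
    rwa [hN, hdiv] at h
  -- a global minimal model `W_m = C • E`, its data, a minimal one
  obtain ⟨C, hC⟩ := hasGlobalMinimalModel_rat_holds (freyCurve a b)
  haveI := hC
  have hNm : (C • freyCurve a b).conductorNorm ℤ = M * q := by rw [conductorNorm_smul_rat, hN]
  have hne : Nonempty (ModularParametrizationData (C • freyCurve a b) (M * q)) :=
    (Summit.ABC.ABC.Theorems.nonempty_modularParametrizationData_smul_iff C).mpr ⟨D⟩
  obtain ⟨D₁, -, hD₁min⟩ := exists_minimal_datum hne
  -- the lattice-optimal datum of the class of `f₁ := D₁.f`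
  obtain ⟨W₀, hW₀, D₀, hf₀, h₀⟩ := D₁.exists_optimalDatum'
  haveI := hW₀
  have hker₀ : D₀.isogenyMap.ker = ⊥ := D₀.isogenyMap_ker_eq_bot_iff.mpr h₀
  have hmin₀ : ∀ (W' : WeierstrassCurve ℚ) [W'.IsElliptic]
      (D' : ModularParametrizationData W' (M * q)), D'.f = D₀.f →
        D₀.modularDegree ≤ D'.modularDegree := fun W' _ D' hD' =>
    D₀.modularDegree_le_of_isogenyMap_ker_eq_bot hker₀ D' hD'
  -- (T_deg) `deg D₁ ≤ 163 · deg D₀`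
  have h163 : D₁.modularDegree ≤ 163 * D₀.modularDegree :=
    stub_pasten163 (M * q) W₀ (C • freyCurve a b) D₀ D₁ hf₀.symm hmin₀ hD₁min
  -- the conductor-restricted optimal pivot `(W⋆, P⋆)`
  obtain ⟨Ws, hWs, Ps, hNs, hfs, hPsmin⟩ := exists_conductorMinimal D₁ hNm
  haveI := hWs
  have h0s : D₀.modularDegree ≤ Ps.modularDegree := hmin₀ Ws Ps (hfs.trans hf₀.symm)
  -- Takahashi at `(W⋆, P⋆)`
  have hTak : Ps.modularDegree ≤ brandtXi M q (fun n => Ws.LFunction n) *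
      (Ws.minimalDiscriminantNorm ℤ).factorization q :=
    takahashi2001_thm_2_3_of_coprime.modularDegree_le_brandtXi_mul stub_takahashi Ws M q hq hcop
      hNs Ps hPsmin
  -- `a(W⋆) = a(f₁) = a(W_m) = a(E)`
  have hL : (fun n => Ws.LFunction n) = fun n => (freyCurve a b).LFunction n := by
    funext n
    have h1 := Ps.isNewformOf.2 n
    have h2 := D₁.isNewformOf.2 n
    rw [hfs] at h1
    rw [h1, LFunction_smul] at h2
    exact_mod_cast h2
  rw [hL] at hTak
  -- (T_val) along `E ~ W_m ~ W⋆`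
  have hiso : (freyCurve a b).IsIsogenous Ws :=
    (isIsogenous_smul (freyCurve a b) C).trans' (isIsogenous_of_f_eq D₁ Ps hfs)
  have hval : (Ws.minimalDiscriminantNorm ℤ).factorization q ≤
      163 * ((freyCurve a b).minimalDiscriminantNorm ℤ).factorization q :=
    stub_valTransport stub_pastenLemma68 a b hab h0 q hq hq2 hqN' Ws hiso
  -- (T_model) back to the Frey model
  obtain ⟨D₁', -, hdeg₁'⟩ := stub_smulTransportDeg C D₁
  have hscale : (C.u : ℚ).num.natAbs ≤ 2 := stub_freyScale a b hab h0 C hC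
  have hD : D.deg ≤ 4 * D₁.modularDegree := by
    calc D.deg ≤ D₁'.deg := hDmin D₁'
      _ = (C.u : ℚ).num.natAbs ^ 2 * D₁.deg := hdeg₁'
      _ ≤ 2 ^ 2 * D₁.deg := Nat.mul_le_mul_right _ (Nat.pow_le_pow_left hscale 2)
      _ = 4 * D₁.modularDegree := by norm_num [ModularParametrizationData.modularDegree]
  -- the chain in `ℕ`
  set ξ : ℕ := brandtXi M q (fun n => (freyCurve a b).LFunction n) with hξ
  set v : ℕ := ((freyCurve a b).minimalDiscriminantNorm ℤ).factorization q with hv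
  have hchain : D.deg ≤ 4 * 163 * 163 * (ξ * v) :=
    calc D.deg ≤ 4 * D₁.modularDegree := hD
      _ ≤ 4 * (163 * D₀.modularDegree) := Nat.mul_le_mul_left _ h163
      _ ≤ 4 * (163 * Ps.modularDegree) := Nat.mul_le_mul_left _ (Nat.mul_le_mul_left _ h0s)
      _ ≤ 4 * (163 * (ξ * (Ws.minimalDiscriminantNorm ℤ).factorization q)) :=
          Nat.mul_le_mul_left _ (Nat.mul_le_mul_left _ hTak)
      _ ≤ 4 * (163 * (ξ * (163 * v))) :=
          Nat.mul_le_mul_left _ (Nat.mul_le_mul_left _ (Nat.mul_le_mul_left _ hval))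
      _ = 4 * 163 * 163 * (ξ * v) := by ring
  -- to `ℝ`, inserting the idle `N^ε ≥ 1`
  have hN1 : (1 : ℝ) ≤ ((M * q : ℕ) : ℝ) := by
    exact_mod_cast Nat.one_le_iff_ne_zero.mpr (NeZero.ne (M * q))
  have hrpow : (1 : ℝ) ≤ ((M * q : ℕ) : ℝ) ^ ε := Real.one_le_rpow hN1 hε.le
  have hcast : (D.deg : ℝ) ≤ (4 * 163 * 163 : ℝ) * ((ξ : ℝ) * (v : ℝ)) := by
    exact_mod_cast hchain
  have hξv : (0 : ℝ) ≤ (ξ : ℝ) * (v : ℝ) := by positivity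
  calc (D.deg : ℝ) ≤ (4 * 163 * 163 : ℝ) * ((ξ : ℝ) * (v : ℝ)) := hcast
    _ = (4 * 163 * 163 : ℝ) * 1 * ((ξ : ℝ) * (v : ℝ)) := by ring
    _ ≤ (4 * 163 * 163 : ℝ) * ((M * q : ℕ) : ℝ) ^ ε * ((ξ : ℝ) * (v : ℝ)) := by gcongr

end Summit.ABC.ABC.Cruxes.DefiniteRTControlPrime.Sketch

end
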